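import Summits.NavierStokesRegularity.NavierStokesRegularity.Cruxes.FlatGaugeAtSingularity.Lines.birth
import Summits.NavierStokesRegularity.NavierStokesRegularity.Theorems.FlatGaugeAtSingularity.Negative.FlatGaugeAtSingularityFalseOfFatVortexLines

/-!
# The registered stubs of line `registered` (= `Lines/birth.lean`) are sandwiched exactly like the crux

Crux workfile (lead c3 of `stmt-NavierStokesRegularity-1252`, 2026-08-17). Kernel-checked bookkeeping for the
verdict `VERDICT-c3.md`: the two registered stubs of the skeleton of record,

* K = `Birth.Sig.stub_vortexChartAtSingularity` (kinematic vortex chart at a singular point) and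
* D = `Birth.Sig.stub_driftSizeRegauge` (re-gauge to drift-size transport defect),

sit, like the crux FG = `FlatSwirlGauge.FlatGaugeAtSingularity` itself, between "no finite-time blow-up in the
Leray–Hopf classical class" (which implies each of them VACUOUSLY) and "a finite-time blow-up exists" (which any
refutation of either of them PRODUCES):

* `sig_stub_vortexChartAtSingularity_of_noBlowup`, `sig_stub_driftSizeRegauge_of_noBlowup` — NoBlowup ⟹ K, D;
* `exists_blowup_of_not_sig_stub_vortexChartAtSingularity`, `exists_blowup_of_not_sig_stub_driftSizeRegauge` —
  ¬K ⟹ blow-up, ¬D ⟹ blow-up (so neither stub is refutable short of exhibiting a singular solution);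
* `sig_stub_vortexChartAtSingularity_false_of_fatVortexLines` — the crux's landed obstruction
  (`Negative/FlatGaugeAtSingularityFalseOfFatVortexLines`) hits the KINEMATIC stub directly: one blow-up with a
  fat frozen-time vortex line inside every backward cylinder at its singular point kills K (hence FG);
* `crux_iff_sig_stubs` — the cut is exact as one `Iff` (FG ⟺ K ∧ D), with the two relative forms
  `sig_stub_driftSizeRegauge_iff_crux` (given K, D ⟺ FG: D is FG conditioned on K) and
  `sig_stub_vortexChartAtSingularity_iff_crux` (given D, K ⟺ FG).

Consequently any proof of K is either a proof that the class has no blow-up or a structure theorem valid for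
ALL blow-ups (an a.e.-nondegenerate bounded `C²` first integral of the frozen vorticity on a fixed ball at all
times near the singular time), and any proof of D given K is the same for the drift-size estimate; neither is in
print (nearest: Constantin 2001 — short-time Weber–Clebsch charts with resetting; KNSS 2009 (1.8) — the
axisymmetric model, `C₁ = 2`). No new mathematics in this file: compositions of landed theorems.
-/

-- the problem namespace `Summit.NavierStokesRegularity.NavierStokesRegularity` repeats the summit name by design (D-0017)
set_option linter.dupNamespace false

noncomputable section

open Set MeasureTheory Metric Function Filter
open scoped RealInnerProductSpace ENNReal Topology
open Literature.Analysis.FluidPDE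
open Summit.NavierStokesRegularity.NavierStokesRegularity.Theses.FlatSwirlGauge
open Summit.NavierStokesRegularity.NavierStokesRegularity.Theorems.FlatGaugeAtSingularity.Negative

namespace Summit.NavierStokesRegularity.NavierStokesRegularity.Cruxes.FlatGaugeAtSingularity.Birth

/-! ### The cut as one `Iff`, and the two relative forms -/

/-- **The cut is exact**: FG ⟺ K ∧ D (composition `FlatGaugeAtSingularity_of` and the two converses
`sig_stub_*_of_crux` of the skeleton, packaged). -/
theorem crux_iff_sig_stubs :
    FlatGaugeAtSingularity ↔ Sig.stub_vortexChartAtSingularity ∧ Sig.stub_driftSizeRegauge :=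
  ⟨fun h => ⟨sig_stub_vortexChartAtSingularity_of_crux h, sig_stub_driftSizeRegauge_of_crux h⟩,
    fun h => FlatGaugeAtSingularity_of h.1 h.2⟩

/-- **D is FG conditioned on K**: once the kinematic stub holds, the dynamic stub is equivalent to the crux. -/
theorem sig_stub_driftSizeRegauge_iff_crux (hK : Sig.stub_vortexChartAtSingularity) :
    Sig.stub_driftSizeRegauge ↔ FlatGaugeAtSingularity :=
  ⟨fun hD => FlatGaugeAtSingularity_of hK hD, sig_stub_driftSizeRegauge_of_crux⟩

/-- Symmetrically, once D holds, K is equivalent to the crux. -/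
theorem sig_stub_vortexChartAtSingularity_iff_crux (hD : Sig.stub_driftSizeRegauge) :
    Sig.stub_vortexChartAtSingularity ↔ FlatGaugeAtSingularity :=
  ⟨fun hK => FlatGaugeAtSingularity_of hK hD, sig_stub_vortexChartAtSingularity_of_crux⟩

/-! ### Upper bound of the sandwich: no blow-up gives both stubs vacuously -/

/-- **NoBlowup ⟹ K.** If every Leray–Hopf classical solution on `[0, T)` from a rapidly decaying datum extends
smoothly past `T` (the antecedent of the route's `NoBlowupToClay`), the kinematic stub holds — vacuously, through
`flatGaugeAtSingularity_of_noBlowup` and `FG ⟹ K`. -/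
theorem sig_stub_vortexChartAtSingularity_of_noBlowup
    (hNB : ∀ (ν T : ℝ), 0 < ν → 0 < T →
      ∀ (u : ℝ → EuclideanSpace ℝ (Fin 3) → EuclideanSpace ℝ (Fin 3)) (p : ℝ → EuclideanSpace ℝ (Fin 3) → ℝ),
      IsClassicalNSSolutionOn (Set.Ico 0 T) ν 0 u p → IsLerayHopfOn T ν 0 (u 0) u →
      HasRapidSpatialDecay (u 0) → HasSmoothExtensionPast ν 0 u T) :
    Sig.stub_vortexChartAtSingularity :=
  sig_stub_vortexChartAtSingularity_of_crux (flatGaugeAtSingularity_of_noBlowup hNB)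

/-- **NoBlowup ⟹ D**, likewise. -/
theorem sig_stub_driftSizeRegauge_of_noBlowup
    (hNB : ∀ (ν T : ℝ), 0 < ν → 0 < T →
      ∀ (u : ℝ → EuclideanSpace ℝ (Fin 3) → EuclideanSpace ℝ (Fin 3)) (p : ℝ → EuclideanSpace ℝ (Fin 3) → ℝ),
      IsClassicalNSSolutionOn (Set.Ico 0 T) ν 0 u p → IsLerayHopfOn T ν 0 (u 0) u →
      HasRapidSpatialDecay (u 0) → HasSmoothExtensionPast ν 0 u T) :
    Sig.stub_driftSizeRegauge :=
  sig_stub_driftSizeRegauge_of_crux (flatGaugeAtSingularity_of_noBlowup hNB)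

/-! ### Lower bound of the sandwich: refuting either stub exhibits a blow-up -/

/-- **¬K ⟹ a finite-time blow-up exists** in the Leray–Hopf classical class (through `FG ⟹ K` and
`exists_blowup_of_not_flatGaugeAtSingularity`): the kinematic stub is not refutable short of a singular solution. -/
theorem exists_blowup_of_not_sig_stub_vortexChartAtSingularity (h : ¬ Sig.stub_vortexChartAtSingularity) :
    ∃ (ν T : ℝ) (u : ℝ → EuclideanSpace ℝ (Fin 3) → EuclideanSpace ℝ (Fin 3))
      (p : ℝ → EuclideanSpace ℝ (Fin 3) → ℝ), 0 < ν ∧ 0 < T ∧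
      IsClassicalNSSolutionOn (Set.Ico 0 T) ν 0 u p ∧ IsLerayHopfOn T ν 0 (u 0) u ∧
      HasRapidSpatialDecay (u 0) ∧ ¬ HasSmoothExtensionPast ν 0 u T :=
  exists_blowup_of_not_flatGaugeAtSingularity fun hFG => h (sig_stub_vortexChartAtSingularity_of_crux hFG)

/-- **¬D ⟹ a finite-time blow-up exists**, likewise. -/
theorem exists_blowup_of_not_sig_stub_driftSizeRegauge (h : ¬ Sig.stub_driftSizeRegauge) :
    ∃ (ν T : ℝ) (u : ℝ → EuclideanSpace ℝ (Fin 3) → EuclideanSpace ℝ (Fin 3))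
      (p : ℝ → EuclideanSpace ℝ (Fin 3) → ℝ), 0 < ν ∧ 0 < T ∧
      IsClassicalNSSolutionOn (Set.Ico 0 T) ν 0 u p ∧ IsLerayHopfOn T ν 0 (u 0) u ∧
      HasRapidSpatialDecay (u 0) ∧ ¬ HasSmoothExtensionPast ν 0 u T :=
  exists_blowup_of_not_flatGaugeAtSingularity fun hFG => h (sig_stub_driftSizeRegauge_of_crux hFG)

/-! ### The crux's kinematic obstruction is an obstruction to K itself -/

/-- **K is false modulo fat vortex lines at a singularity.** If some Leray–Hopf classical solution from a
decaying datum has a singular point `(T, x₀)` such that every backward cylinder `Q_ρ(T, x₀)` contains, at some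
admissible time, a vortex line (integral curve of the frozen vorticity) staying in `B_ρ(x₀)` whose orbit closure
meets `{curl u ≠ 0} ∩ B_ρ(x₀)` in positive volume, then the kinematic stub fails: the chart K would provide on some
`Q_ρ(T, x₀)` is killed by `not_isVortexChartOn_of_fat_vortexLine`. (Same hypothesis, verbatim, as
`flatGaugeAtSingularity_false_of_fatVortexLines`; here it is seen to bite before any dynamics.) -/
theorem sig_stub_vortexChartAtSingularity_false_of_fatVortexLines
    (H : ∃ (ν T : ℝ) (u : ℝ → EuclideanSpace ℝ (Fin 3) → EuclideanSpace ℝ (Fin 3))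
      (p : ℝ → EuclideanSpace ℝ (Fin 3) → ℝ) (x₀ : EuclideanSpace ℝ (Fin 3)), 0 < ν ∧ 0 < T ∧
      IsClassicalNSSolutionOn (Set.Ico 0 T) ν 0 u p ∧ IsLerayHopfOn T ν 0 (u 0) u ∧
      HasRapidSpatialDecay (u 0) ∧
      ¬ (∃ r : ℝ, 0 < r ∧ ∃ K : ℝ, ∀ t ∈ Set.Ioo (T - r ^ 2) T, 0 ≤ t →
          ∀ x ∈ Metric.ball x₀ r, ‖u t x‖ ≤ K) ∧
      ∀ ρ : ℝ, 0 < ρ → ρ ^ 2 < T → ∃ t ∈ Ioo (T - ρ ^ 2) T,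
        ∃ γ : ℝ → EuclideanSpace ℝ (Fin 3), (∀ s, HasDerivAt γ (curl (u t) (γ s)) s) ∧
        (∀ s, γ s ∈ ball x₀ ρ) ∧
        volume (closure (range γ) ∩ ball x₀ ρ ∩ {x | curl (u t) x ≠ 0}) ≠ 0) :
    ¬ Sig.stub_vortexChartAtSingularity := by
  intro hK
  obtain ⟨ν, T, u, p, x₀, hν, hT, hcl, hLH, hdec, hsing, hfvl⟩ := H
  obtain ⟨ρ, C₀, M, α, d, hchart⟩ := hK ν T hν hT u p hcl hLH hdec x₀ hsing
  obtain ⟨t, ht, γ, hγ, hγB, hfat⟩ := hfvl ρ hchart.1 hchart.2.1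
  exact not_isVortexChartOn_of_fat_vortexLine ht hγ hγB hfat hchart

end Summit.NavierStokesRegularity.NavierStokesRegularity.Cruxes.FlatGaugeAtSingularity.Birth

end
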